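import Summits.HodgeConjecture.HodgeConjecture.Theorems.F0D6CmCurveBodyStubShapes   -- ★ previous part of the same Lines workfile `D6CmCurveBody` (size-lint split ×6)
import HarnessLib

/-!
# `F0D6CmCurveBody` — ★ RE-HOME of `Lines/D6CmCurveBody.lean`, PART 6 of 6 (size-lint split; cut at a top-level declaration boundary).

See PART 1 `Theorems/F0D6CmCurveBodyHonest.lean` for the full re-home header and the original module docstring (verbatim there). Namespaces KEPT
(re-opened below exactly as they stand at the cut, with their `open` lines); code bytes = the workfile՚s, docstrings included; options preamble repeated from PART 1.
HC_CM is proved only modulo the 7 printed citations (2 remaining: hLiu418 = stmt-HodgeConjecture-24832, h413 = stmt-HodgeConjecture-24833) until rung 0 closes; a re-home is count-neutral. -/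

noncomputable section

open scoped TensorProduct NumberField
open NumberField IsDedekindDomain Filter
open Literature.NumberTheory.GaloisRepresentations
open Literature.NumberTheory.Automorphic
open Literature.NumberTheory.Automorphic.Liu2021.AppendixC
open scoped TensorProduct Matrix NumberField Kronecker ComplexOrder
open NumberField NumberField.InfinitePlace IsDedekindDomain
open Summit.HodgeConjecture.CorCM.Model Summit.HodgeConjecture.CorCM.Model.HComp Summit.HodgeConjecture.CorCM.HComp
open Literature.AlgebraicGeometry.Motives (CMType)
open Literature.AlgebraicGeometry.ShimuraVarieties.UnitaryCanonicalModel
open Literature.NumberTheory.Automorphic Literature.NumberTheory.Automorphic.UnitaryGroup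
open Literature.NumberTheory.Automorphic.IdeleClassGroup Literature.NumberTheory.Automorphic.Liu2021 Literature.NumberTheory.Automorphic.Liu2021.AppendixC
open Literature.NumberTheory.GaloisRepresentations Literature.RepresentationTheory.Liu2021 Literature.RepresentationTheory.HarrisKudlaSweet1996
open Literature.AlgebraicGeometry.Liu2021 (IsAdmissibleElement)
open Literature.NumberTheory.Weil1964 Literature.NumberTheory.GelbartRogawski1991 Literature.NumberTheory.GelbartRogawski1991.UnitaryDualPair Literature.NumberTheory.GelbartRogawski1991.UnitaryDualPair.WeilCoinv
open Literature.NumberTheory.GelbartRogawski1991.UnitaryDualPair.LocalSplitting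
open Literature.NumberTheory.Automorphic.Liu2021.Def411WeilCarriersDoubling
open Literature.NumberTheory.Automorphic.Liu2021.Def411WeilCarriers (TW JW JW_eq isSymm_TW isUnit_det_TW Rep Eps epsOf Chi rhoVAtLine)


set_option autoImplicit false

noncomputable section

open CategoryTheory NumberField
open scoped TensorProduct
open Literature.AlgebraicGeometry.Motives
open Literature.AlgebraicGeometry.Motives.AbelianVariety (rationalTateModuleMap rationalTateAction image toImage)

-- top-level `open`/option lines of the workfile in force at this cut (replayed):
set_option autoImplicit false
open CategoryTheory NumberField
open scoped TensorProduct
open Literature.AlgebraicGeometry.Motives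
open Literature.AlgebraicGeometry.Motives.AbelianVariety (rationalTateModuleMap rationalTateAction image toImage)
open scoped TensorProduct Matrix NumberField Kronecker ComplexOrder
open NumberField NumberField.InfinitePlace IsDedekindDomain
open Summit.HodgeConjecture.CorCM.Model Summit.HodgeConjecture.CorCM.Model.HComp Summit.HodgeConjecture.CorCM.HComp
open Literature.AlgebraicGeometry.Motives (CMType)
open Literature.AlgebraicGeometry.ShimuraVarieties.UnitaryCanonicalModel
open Literature.NumberTheory.Automorphic Literature.NumberTheory.Automorphic.UnitaryGroup
open Literature.NumberTheory.Automorphic.IdeleClassGroup Literature.NumberTheory.Automorphic.Liu2021 Literature.NumberTheory.Automorphic.Liu2021.AppendixC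
open Literature.NumberTheory.GaloisRepresentations Literature.RepresentationTheory.Liu2021 Literature.RepresentationTheory.HarrisKudlaSweet1996
open Literature.AlgebraicGeometry.Liu2021 (IsAdmissibleElement)
open Literature.NumberTheory.Weil1964 Literature.NumberTheory.GelbartRogawski1991 Literature.NumberTheory.GelbartRogawski1991.UnitaryDualPair Literature.NumberTheory.GelbartRogawski1991.UnitaryDualPair.WeilCoinv
open Literature.NumberTheory.GelbartRogawski1991.UnitaryDualPair.LocalSplitting
open Literature.NumberTheory.Automorphic.Liu2021.Def411WeilCarriersDoubling
open Literature.NumberTheory.Automorphic.Liu2021.Def411WeilCarriers (TW JW JW_eq isSymm_TW isUnit_det_TW Rep Eps epsOf Chi rhoVAtLine)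

/-! ## Part N — ROAD (P) RE-DRAWN (A-plan2 (g12) 03:53:02Z + 03:50:18Z (v)-letter): the (iv) letter is `RosHShape` (positive anti-involution
ON `heckeImage K`), the (v) letter is the producer head `MultOneShapePH`; TAIL B‴ = {`stub_S1`, `stub_S1b`, `stub_RosH`, `stub_MultOne`, `stub_D9op`}. -/

namespace Summit.HodgeConjecture.CorCM.Lines.A3Liu418

open Summit.HodgeConjecture.CorCM.HypLiu418.S2prime Literature.NumberTheory.Automorphic.Liu2021.AppendixC.S2primeProbe

/-- **S2′ input (iv), weakened letter of record — `RosHShape`**: at the registered GS Hecke translates / isogeny descent, every small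
level՚s Hecke image `H_K` carries a positive anti-involution of its own ([Liu2021, (D.3) p. 133]: the Hecke algebra՚s `[KgK] ↦ [Kg⁻¹K]`
is the Rosati adjoint; [Lange, Prop. 11.5.3]). -/
def RosHShape : Prop :=
  ∀ (F : CMField) [IsGalois ℚ F] (ι₁ : F →+* ℂ)
    (μ : Literature.NumberTheory.Automorphic.IdeleClassGroup (F : Type) →ₜ* Circle)
    (hμ : IdeleClassGroup.IsConjugateSymplectic (F : Type) μ)
    (_hw : IdeleClassGroup.HasWeight (F : Type) μ 1)
    (ℓ : ℕ) [Fact ℓ.Prime] (ι' : ℂ ≃+* AlgebraicClosure ℚ_[ℓ])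
    (Jstar : Matrix (Fin 2) (Fin 2) (F : Type)) (t : (F : Type)) (ht : t ≠ 0) (_hτt : 0 < (ι₁ t).re) (_hτt' : (ι₁ t).im = 0)
    (gstar : GL (Fin 2) (F : Type))
    (dJ : Fin 2 → (F : Type)) (hdJ : ∀ i, IsCMField.complexConj (F : Type) (dJ i) = dJ i) (hdJ0 : ∀ i, dJ i ≠ 0)
    (hg : formCongr ((IsCMField.complexConj (F : Type) : (F : Type) ≃ₐ[↥(maximalRealSubfield (F : Type))] (F : Type)) :
        (F : Type) →+* (F : Type)) gstar (t • Jstar) = Matrix.diagonal dJ)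
    (_hsig : (∃ Tstar : GL (Fin 2) ℂ,
        formCongr (starRingEnd ℂ) Tstar ((Matrix.diagonal dJ).map ι₁) = Matrix.diagonal ![(1 : ℂ), -1]) ∧
      ∀ τ' : (F : Type) →+* ℂ, InfinitePlace.mk τ' ≠ InfinitePlace.mk ι₁ → ((Matrix.diagonal dJ).map τ').PosDef)
    (K₀ : C5.OpenCompactSubgroup ↥(finAdelic ↥(maximalRealSubfield (F : Type)) (F : Type) (IsCMField.complexConj (F : Type)) 2 Jstar))
    (S : RecordSystemGS (F : Type) Jstar ι₁ K₀) (hU7ₛ : S.HeckeTranslateDefinedOver) (hLQ : S.IsLevelQuotient)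
    (h4 : 4 ≤ Module.finrank ℚ (F : Type)) (isoₛ : ℕ → Prop)
    (r : Rep ↥(maximalRealSubfield (F : Type)) (imagUnitSq F))
    (ε : Eps ↥(maximalRealSubfield (F : Type)) (imagUnitSq F))
    (_hadm : ∃ e : (F : Type), IsAdmissibleElement (F : Type) hμ.cmType.1 e ∧
      epsOf ↥(maximalRealSubfield (F : Type)) (imagUnitSq F) (F : Type) (2 * imagUnit (F : Type))⁻¹ (-e) = ε)
    (χ : Chi ↥(maximalRealSubfield (F : Type)) (F : Type) (IsCMField.complexConj (F : Type))),
      SocketRosH (sec42HeckeTranslatesGS S hU7ₛ h4 isoₛ) (isogenyDescent_GS S hU7ₛ hLQ h4 isoₛ)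

/-- `RosHShape` ⇐ `RosShape` (the junction `socketRosH_of_socketRos`, ★ Milne CM Prop. 1.37). -/
theorem rosHShape_of_rosShape (h : RosShape) : RosHShape :=
  fun F _ ι₁ μ hμ hw ℓ _ ι' Jstar t ht hτt hτt' gstar dJ hdJ hdJ0 hg hsig K₀ S hU7ₛ hLQ h4 isoₛ r ε hadm χ => socketRosH_of_socketRos _ _ (h F ι₁ μ hμ hw ℓ ι' Jstar t ht hτt hτt' gstar dJ hdJ hdJ0 hg hsig K₀ S hU7ₛ hLQ h4 isoₛ r ε hadm χ)

/-- `RosZShape` ⇐ `RosHShape` (`socketRosZ_of_socketRosH`, ★ p757326 inside `H_K`). -/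
theorem rosZShape_of_rosHShape (h : RosHShape) : RosZShape :=
  fun F _ ι₁ μ hμ hw ℓ _ ι' Jstar t ht hτt hτt' gstar dJ hdJ hdJ0 hg hsig K₀ S hU7ₛ hLQ h4 isoₛ r ε hadm χ => socketRosZ_of_socketRosH _ _ (h F ι₁ μ hμ hw ℓ ι' Jstar t ht hτt hτt' gstar dJ hdJ hdJ0 hg hsig K₀ S hU7ₛ hLQ h4 isoₛ r ε hadm χ)

/-- **S2′ input (v), producer letter of record — `MultOneShapePH`**: A-p05 (g12)՚s frozen (MO) head / A-p07 (g12)՚s `exists_block_multOne` read at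
the registered binders with the LEVELWISE-σ-free inputs: under `SocketRosH` (whence `hH`, `hssM`) and Mathlib-irreducibility of `ω⋆` (the
non-zero branch), the (MO-producer) socket `SocketMultOne` holds. -/
def MultOneShapePH : Prop :=
  ∀ (F : CMField) [IsGalois ℚ F] (ι₁ : F →+* ℂ)
    (μ : Literature.NumberTheory.Automorphic.IdeleClassGroup (F : Type) →ₜ* Circle)
    (hμ : IdeleClassGroup.IsConjugateSymplectic (F : Type) μ)
    (_hw : IdeleClassGroup.HasWeight (F : Type) μ 1)
    (ℓ : ℕ) [Fact ℓ.Prime] (ι' : ℂ ≃+* AlgebraicClosure ℚ_[ℓ])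
    (Jstar : Matrix (Fin 2) (Fin 2) (F : Type)) (t : (F : Type)) (ht : t ≠ 0) (_hτt : 0 < (ι₁ t).re) (_hτt' : (ι₁ t).im = 0)
    (gstar : GL (Fin 2) (F : Type))
    (dJ : Fin 2 → (F : Type)) (hdJ : ∀ i, IsCMField.complexConj (F : Type) (dJ i) = dJ i) (hdJ0 : ∀ i, dJ i ≠ 0)
    (hg : formCongr ((IsCMField.complexConj (F : Type) : (F : Type) ≃ₐ[↥(maximalRealSubfield (F : Type))] (F : Type)) :
        (F : Type) →+* (F : Type)) gstar (t • Jstar) = Matrix.diagonal dJ)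
    (_hsig : (∃ Tstar : GL (Fin 2) ℂ,
        formCongr (starRingEnd ℂ) Tstar ((Matrix.diagonal dJ).map ι₁) = Matrix.diagonal ![(1 : ℂ), -1]) ∧
      ∀ τ' : (F : Type) →+* ℂ, InfinitePlace.mk τ' ≠ InfinitePlace.mk ι₁ → ((Matrix.diagonal dJ).map τ').PosDef)
    (K₀ : C5.OpenCompactSubgroup ↥(finAdelic ↥(maximalRealSubfield (F : Type)) (F : Type) (IsCMField.complexConj (F : Type)) 2 Jstar))
    (S : RecordSystemGS (F : Type) Jstar ι₁ K₀) (hU7ₛ : S.HeckeTranslateDefinedOver) (hLQ : S.IsLevelQuotient)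
    (h4 : 4 ≤ Module.finrank ℚ (F : Type)) (isoₛ : ℕ → Prop)
    (r : Rep ↥(maximalRealSubfield (F : Type)) (imagUnitSq F))
    (ε : Eps ↥(maximalRealSubfield (F : Type)) (imagUnitSq F))
    (_hadm : ∃ e : (F : Type), IsAdmissibleElement (F : Type) hμ.cmType.1 e ∧
      epsOf ↥(maximalRealSubfield (F : Type)) (imagUnitSq F) (F : Type) (2 * imagUnit (F : Type))⁻¹ (-e) = ε)
    (χ : Chi ↥(maximalRealSubfield (F : Type)) (F : Type) (IsCMField.complexConj (F : Type))),
      SocketRosH (sec42HeckeTranslatesGS S hU7ₛ h4 isoₛ) (isogenyDescent_GS S hU7ₛ hLQ h4 isoₛ) →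
        Representation.IsIrreducible
        ((rhoVAtLine ↥(maximalRealSubfield (F : Type)) (F : Type) (IsCMField.complexConj (F : Type)) 2
          (finProdFinEquiv : Fin 2 × Fin 1 ≃ Fin (2 * 1)) (Matrix.diagonal dJ)
          (complexConj_imagUnit F) (imagUnit_ne_zero F) (imagUnit_mul_self F) (realDiagonal_isSymm F dJ hdJ)
          (isUnit_det_realDiagonal F dJ hdJ hdJ0) (realDiagonal_map F dJ hdJ).symm
          (hsChiGS F finProdFinEquiv dJ hdJ hdJ0
            (toHeckeCharacter (F : Type) (galConj (IsCMField.complexConj (F : Type)) μ))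
            (isUnitary_toHeckeCharacter (F : Type) (galConj (IsCMField.complexConj (F : Type)) μ))
            ((isOscillatorChar_toHeckeCharacter_iff (galConj (IsCMField.complexConj (F : Type)) μ)).mpr hμ.galConj))
          (r.toFun ε) χ).comp
          (finAdelicCongr ↥(maximalRealSubfield (F : Type)) (F : Type) (IsCMField.complexConj (F : Type)) gstar ht hg).symm.toMonoidHom) →
        SocketMultOne ℓ (etaleHeckeDatumGS S hU7ₛ hLQ h4 isoₛ ℓ) ι' ((rhoVAtLine ↥(maximalRealSubfield (F : Type)) (F : Type) (IsCMField.complexConj (F : Type)) 2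
          (finProdFinEquiv : Fin 2 × Fin 1 ≃ Fin (2 * 1)) (Matrix.diagonal dJ)
          (complexConj_imagUnit F) (imagUnit_ne_zero F) (imagUnit_mul_self F) (realDiagonal_isSymm F dJ hdJ)
          (isUnit_det_realDiagonal F dJ hdJ hdJ0) (realDiagonal_map F dJ hdJ).symm
          (hsChiGS F finProdFinEquiv dJ hdJ hdJ0
            (toHeckeCharacter (F : Type) (galConj (IsCMField.complexConj (F : Type)) μ))
            (isUnitary_toHeckeCharacter (F : Type) (galConj (IsCMField.complexConj (F : Type)) μ))
            ((isOscillatorChar_toHeckeCharacter_iff (galConj (IsCMField.complexConj (F : Type)) μ)).mpr hμ.galConj))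
          (r.toFun ε) χ).comp
          (finAdelicCongr ↥(maximalRealSubfield (F : Type)) (F : Type) (IsCMField.complexConj (F : Type)) gstar ht hg).symm.toMonoidHom) (sec42HeckeTranslatesGS S hU7ₛ h4 isoₛ) (isogenyDescent_GS S hU7ₛ hLQ h4 isoₛ)

/-- **S2′ FROM THREE STUB SHAPES, road (P) re-drawn: `S2primeShape ⇐ IrrOrZeroOmegaStarShape ∧ RosHShape ∧ MOShape`** (`SocketKw` ★ p757315
inside; semisimplicity of every `H_K` and positivity on every block presentation from the involution on `H_K`; `σ` constructed). -/
theorem s2primeShape_of_stubShapes_H (hIrr : IrrOrZeroOmegaStarShape) (hRosH : RosHShape) (hMO : MOShape) : S2primeShape := by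
  refine s2primeShape_of'' fun F _ ι₁ μ hμ hw ℓ _ ι' Jstar t ht hτt hτt' gstar dJ hdJ hdJ0 hg hsig K₀ S hU7ₛ hLQ h4 isoₛ r ε hadm χ => ?_
  exact blockShape'_of_socketsPH ℓ (etaleHeckeDatumGS S hU7ₛ hLQ h4 isoₛ ℓ) ι' _ (sec42HeckeTranslatesGS S hU7ₛ h4 isoₛ)
    (isogenyDescent_GS S hU7ₛ hLQ h4 isoₛ)
    (hIrr F ι₁ μ hμ hw ℓ ι' Jstar t ht hτt hτt' gstar dJ hdJ hdJ0 hg hsig K₀ S hU7ₛ hLQ h4 isoₛ r ε hadm χ) (hI_GS S h4 isoₛ ℓ) rfl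
    (socketKw_of_isSmoothRep (isSmoothRep_omegaStarGS F dJ hdJ hdJ0 _ _ _ (r.toFun ε) χ ht gstar hg))
    (hRosH F ι₁ μ hμ hw ℓ ι' Jstar t ht hτt hτt' gstar dJ hdJ hdJ0 hg hsig K₀ S hU7ₛ hLQ h4 isoₛ r ε hadm χ)
    (hMO F ι₁ μ hμ hw ℓ ι' Jstar t ht hτt hτt' gstar dJ hdJ hdJ0 hg hsig K₀ S hU7ₛ hLQ h4 isoₛ r ε hadm χ)

/-- **S2′ FROM THE TAIL B‴ STUBS: `S2primeShape ⇐ IrrOrZeroOmegaStarShape ∧ RosHShape ∧ MultOneShapePH ∧ S1Shape`** — the (MO-producer)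
socket is asked only on the irreducible branch, multiplicity one comes from the line՚s own `S1Shape` through `socketM1_of_pairwise`. -/
theorem s2primeShape_of_stubShapesM1H (hIrr : IrrOrZeroOmegaStarShape) (hRosH : RosHShape) (hM : MultOneShapePH)
    (hS1 : S1Shape) : S2primeShape := by
  refine s2primeShape_of'' fun F _ ι₁ μ hμ hw ℓ _ ι' Jstar t ht hτt hτt' gstar dJ hdJ hdJ0 hg hsig K₀ S hU7ₛ hLQ h4 isoₛ r ε hadm χ => ?_
  exact blockShape'_of_socketsPHM1 ℓ (etaleHeckeDatumGS S hU7ₛ hLQ h4 isoₛ ℓ) ι' _ (sec42HeckeTranslatesGS S hU7ₛ h4 isoₛ)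
    (isogenyDescent_GS S hU7ₛ hLQ h4 isoₛ)
    (hIrr F ι₁ μ hμ hw ℓ ι' Jstar t ht hτt hτt' gstar dJ hdJ hdJ0 hg hsig K₀ S hU7ₛ hLQ h4 isoₛ r ε hadm χ) (hI_GS S h4 isoₛ ℓ) rfl
    (socketKw_of_isSmoothRep (isSmoothRep_omegaStarGS F dJ hdJ hdJ0 _ _ _ (r.toFun ε) χ ht gstar hg))
    (hRosH F ι₁ μ hμ hw ℓ ι' Jstar t ht hτt hτt' gstar dJ hdJ hdJ0 hg hsig K₀ S hU7ₛ hLQ h4 isoₛ r ε hadm χ)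
    (fun hirr => hM F ι₁ μ hμ hw ℓ ι' Jstar t ht hτt hτt' gstar dJ hdJ hdJ0 hg hsig K₀ S hU7ₛ hLQ h4 isoₛ r ε hadm χ (hRosH F ι₁ μ hμ hw ℓ ι' Jstar t ht hτt hτt' gstar dJ hdJ hdJ0 hg hsig K₀ S hU7ₛ hLQ h4 isoₛ r ε hadm χ) hirr)
    (socketM1_of_pairwise ℓ _ ι' _ (hS1 F ι₁ μ hμ hw ℓ ι' Jstar t ht hτt hτt' gstar dJ hdJ hdJ0 hg hsig K₀ S hU7ₛ hLQ h4 isoₛ r ε hadm χ))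

end Summit.HodgeConjecture.CorCM.Lines.A3Liu418

/-! ## Part K′ — ROAD (P), σ-FREE REGISTRATION TEXT (A-plan2 (g12) 03:26:58Z ask; A-p09 (g14) (O-III) + A-p10 (g12) ★ p758618):
`S2primeShape` ⇐ `IrrOrZeroOmegaStarShape` ∧ `RosShape` ∧ `MOShape` — `S1cSigmaShape` has LEFT the composition. -/

namespace Summit.HodgeConjecture.CorCM.Lines.A3Liu418

open Summit.HodgeConjecture.CorCM.HypLiu418.S2prime Literature.NumberTheory.Automorphic.Liu2021.AppendixC.S2primeProbe

/-- **S2′ FROM THREE STUB SHAPES, σ-FREE (road (P))**: `stub_S2′ : S2primeShape` is replaced by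
`s2primeShape_of_stubShapes_sigmaFree stub_IrrOrZeroOmegaStar stub_Ros stub_MO`; `SocketKw` ★ p757315 inside, the levelwise semisimplicity
(`hH`, `hssM`) from the positive involution (★ p758618), the (4′) socket from A-p09 (g14)՚s levelwise chain, `σ = 1 ⊗ rhoEt` constructed. -/
theorem s2primeShape_of_stubShapes_sigmaFree (hIrr : IrrOrZeroOmegaStarShape) (hRos : RosShape) (hMO : MOShape) :
    S2primeShape :=
  s2primeShape_of_stubShapes_H hIrr (rosHShape_of_rosShape hRos) hMO

end Summit.HodgeConjecture.CorCM.Lines.A3Liu418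

/-! ## Part M — INPUT (i) IS A THEOREM (A-p13 (g19) ★ p759294 `A3Liu418GSOmegaStarIrreducibleOrZero`): `irrOrZeroOmegaStarShape_holds`, and the
σ-free registration head with TWO stubs left on the S2′ node: `s2primeShape_of_Ros_MO (hRos : RosShape) (hMO : MOShape) : S2primeShape`. -/

namespace Summit.HodgeConjecture.CorCM.Lines.A3Liu418

open Summit.HodgeConjecture.CorCM.HypLiu418.S2prime Literature.NumberTheory.Automorphic.Liu2021.AppendixC.S2primeProbe

/-- **S2′ input (i) DISCHARGED**: the registered d6 carrier `ω⋆` is irreducible-or-zero in Liu՚s sense at every registered binder tuple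
(★ p759294 `isIrreducibleOrZero_omegaStarGS`, uncurried over the 30 binders). -/
theorem irrOrZeroOmegaStarShape_holds : IrrOrZeroOmegaStarShape :=
  fun F _ _ _ _ _ _ _ _ _ _ ht _ _ gstar dJ hdJ hdJ0 hg _ _ _ _ _ _ _ r ε _ χ =>
    isIrreducibleOrZero_omegaStarGS F dJ hdJ hdJ0 _ _ _ (r.toFun ε) χ ht gstar hg

/-- **S2′ AT THE REGISTERED BINDERS FROM TWO STUBS — road (P), σ-free, input (i) a theorem**: `S2primeShape ⇐ RosShape ∧ MOShape`. -/
theorem s2primeShape_of_Ros_MO (hRos : RosShape) (hMO : MOShape) : S2primeShape :=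
  s2primeShape_of_stubShapes_sigmaFree irrOrZeroOmegaStarShape_holds hRos hMO


/-- **THE REGISTRATION HEAD OF RECORD (TAIL B‴, input (i) a theorem ★ p759294): `S2primeShape ⇐ RosHShape ∧ MultOneShapePH ∧ S1Shape`.**
`s2primeShape_holds := s2primeShape_of_RosH_MultOne_S1 stub_RosH stub_MultOne stub_S1` (B‴ era; vB6: `stub_RosH` ↦ `rosH_holds hFR hFP2`, `stub_MultOne` struck). -/
theorem s2primeShape_of_RosH_MultOne_S1 (hRosH : RosHShape) (hM : MultOneShapePH) (hS1 : S1Shape) : S2primeShape :=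
  s2primeShape_of_stubShapesM1H irrOrZeroOmegaStarShape_holds hRosH hM hS1

/-- Variant without the (MO) split: `S2primeShape ⇐ RosHShape ∧ MOShape`. -/
theorem s2primeShape_of_RosH_MO (hRosH : RosHShape) (hMO : MOShape) : S2primeShape :=
  s2primeShape_of_stubShapes_H irrOrZeroOmegaStarShape_holds hRosH hMO

end Summit.HodgeConjecture.CorCM.Lines.A3Liu418

/-! ## Part O — THE (MO) PRODUCER IS IN (A-p07 (g12) `exists_block_multOne`, levelwise letter v2): `multOneShapePH_holds`, and the S2′ node with
## ONE new stub: `s2primeShape_of_RosH_S1 (hRosH : RosHShape) (hS1 : S1Shape) : S2primeShape`. -/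

namespace Summit.HodgeConjecture.CorCM.Lines.A3Liu418

open Summit.HodgeConjecture.CorCM.HypLiu418.S2prime Literature.NumberTheory.Automorphic.Liu2021.AppendixC.S2primeProbe

/-- **S2′ input (v) DISCHARGED**: the producer letter `MultOneShapePH` HOLDS (A-p07 (g12) `exists_block_multOne` through
`socketMultOne_of_socketRosH`, at `X := etaleHeckeDatumGS`, `T := sec42HeckeTranslatesGS`, `hD := isogenyDescent_GS`, `hI := hI_GS`, `hX := rfl`). -/
theorem multOneShapePH_holds : MultOneShapePH :=
  fun F _ _ _ _ _ ℓ _ ι' _ _ _ _ _ _ _ _ _ _ _ _ S hU7ₛ hLQ h4 isoₛ _ _ _ _ hRosH hirr => by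
    haveI := hirr
    exact socketMultOne_of_socketRosH ℓ (etaleHeckeDatumGS S hU7ₛ hLQ h4 isoₛ ℓ) ι' _ (sec42HeckeTranslatesGS S hU7ₛ h4 isoₛ)
      (isogenyDescent_GS S hU7ₛ hLQ h4 isoₛ) (hI_GS S h4 isoₛ ℓ) rfl hRosH

/-- **THE S2′ NODE WITH ONE NEW STUB: `S2primeShape ⇐ RosHShape ∧ S1Shape`** — input (i) ★ p759294, (iii) ★ p757315, (v) A-p07 (g12)՚s producer,
S1c eliminated (A-p09 (O-III) + A-p10 ★ p758618), the Betti/rank-one road ★ (p752558′ · p752758 · p752842 · p753523 · p753789 · p754367 · p755062 ·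
p754669 · p755487 · p755878 · p756436/p759704 · p757326 · p757337); what remains is the ROSATI INPUT ON `H_K` (`RosHShape`, road (P), next run) and the
line՚s own multiplicity-one stub `S1Shape`.  `s2primeShape_holds hFR hFP2 := s2primeShape_of_RosH_S1 (rosH_holds hFR hFP2) stub_S1` (vB6). -/
theorem s2primeShape_of_RosH_S1 (hRosH : RosHShape) (hS1 : S1Shape) : S2primeShape :=
  s2primeShape_of_RosH_MultOne_S1 hRosH multOneShapePH_holds hS1

end Summit.HodgeConjecture.CorCM.Lines.A3Liu418
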